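import Mathlib
import Summits.ValiantsHypothesis.ValiantsHypothesis.Theorems.RigidityForcesSymmetryRankRigidMinimalReprLaplaceFiveCertified
import Summits.ValiantsHypothesis.ValiantsHypothesis.Theorems.RigidityForcesSymmetryRankRigidMinimalReprLaplaceSupportCoreWitness

/-!
# `LaplaceOptimalFive`: decompositions of `P₅` refuted by a SUPPORT-CORE certificate
# (crux `RankRigidMinimalRepr`, stmt-ValiantsHypothesis-18034; frontier rung `LaplaceOptimalFive`, stmt-24813)

The `d = 5` wrapper over the support-core witness engine `LaplaceTriangular.core_witness`
(`…LaplaceSupportCoreWitness.lean`), in the term format of `certified_no_decomposition` / `certified_no_decomposition2`: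

* `refute_of_kills` — the bookkeeping half, factored out: slices `α_k(v_{i k}) · W_k(v)` and pair terms
  `u_t(v_{p t}, v_{q t}) · w_t(v)`, a kill side per pair term (`u`-side charged at `lp t ∈ {p t, q t}` with the other
  endpoint `op t`; `w`-side charged at `lp t` with `{e1 t, e2 t, lp t} = {p t, q t}ᶜ`); ANY covector tuple with non-zero
  permanent that is orthogonal to every slice vector at its slot and kills every pair constraint vector at its charged
  slot refutes the decomposition identity (`LaplaceDual.no_decomposition_of_witness`, `kill_slice`, `kill_pair`,
  `pairing_compl_three`).
* `core_no_decomposition` — the certificate: slot order `ord`, core positions `j0, j0 + 1`, kill sides (`u`-side: the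
  other endpoint `e1 t` earlier; `w`-side: `e1 t, e2 t` earlier), and the COUNTS: general position `j ∉ {j0, j0+1}`:
  `#slices@(ord j) + #pairs charged@(ord j) + j + 1 ≤ 5`; core: `… + j0 + 3 ≤ 5` at `j0` and `… + j0 + 1 ≤ 5` at
  `j0 + 1`.  All certificate conditions are decidable from `(i, p, q)` and the certificate.

By exhaustive search (p8 g11, evidence on stmt-24813) this certificate shape covers three of the ten residual `a = 3`
types of the interleaved certificate (`…LaplaceFiveCertified2.lean`): slices `{x,y,z}` or `{x,x,y}` with the triple
pair cut `3·{xy}` (loads `(1,4,1,0,0)` / `(2,4,0,0,0)`, core at `j0 = 0`), and slices `{x,x,x}` with a double edge plus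
the disjoint edge (loads `(3,0,3,0,0)`, core at `j0 = 1`, the disjoint edge killed on its 3-slot side).  No definitions.
HONEST FRAMING: infrastructure for the frontier rung `LaplaceOptimalFive` (stmt-24813), which stays OPEN; nothing here
bears on `VP ≠ VNP`.
-/

set_option autoImplicit false

-- the mandated summit-side namespace repeats a component by design (single-problem summit)
set_option linter.dupNamespace false

namespace Summit.ValiantsHypothesis.ValiantsHypothesis.Theorems.RigidityForcesSymmetryRankRigidMinimalRepr

namespace LaplaceFiveSlices

open Finset

/-! ### §1 Kills refute -/

/-- **Kills refute.**  Slices `α_k(v_{i k}) · W_k(v)` (`W_k` blind to slot `i k`) and pair terms `u_t(v_{p t}, v_{q t}) · w_t(v)`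
(`w_t` blind to `p t, q t`); for every pair term a kill side: `side t = false` — the `u`-side, charged at `lp t ∈ {p t, q t}`
with other endpoint `op t`; `side t = true` — the `w`-side, charged at `lp t` with `{e1 t, e2 t, lp t}` the three slots off
`{p t, q t}`.  If a covector tuple `φ` (one covector per slot) has NON-ZERO permanent, is orthogonal to every `α_k` at slot
`i k`, and kills every pair term's charged constraint vector (`Σ_y φ_{lp t}(y) · n_t(φ)(y) = 0`, with `n_t` the contraction
of `u_t` against `φ_{op t}`, resp. of `w_t` against `φ_{e1 t} ⊗ φ_{e2 t}`), then the decomposition identity is impossible. -/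
theorem refute_of_kills {Ns Np : ℕ}
    (i : Fin Ns → Fin 5) (α : Fin Ns → Fin 5 → ℂ) (W : Fin Ns → (Fin 5 → Fin 5) → ℂ)
    (hW : ∀ k, ∀ v v' : Fin 5 → Fin 5, (∀ j, j ≠ i k → v j = v' j) → W k v = W k v')
    (p q : Fin Np → Fin 5) (hpq : ∀ t, p t ≠ q t) (u w : Fin Np → (Fin 5 → Fin 5) → ℂ)
    (hu : ∀ t, ∀ v v' : Fin 5 → Fin 5, v (p t) = v' (p t) → v (q t) = v' (q t) → u t v = u t v')
    (hw : ∀ t, ∀ v v' : Fin 5 → Fin 5, (∀ j, j ≠ p t → j ≠ q t → v j = v' j) → w t v = w t v')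
    (side : Fin Np → Bool) (lp op e1 e2 : Fin Np → Fin 5)
    (hsideU : ∀ t, side t = false → (lp t = p t ∧ op t = q t ∨ lp t = q t ∧ op t = p t))
    (hsideW : ∀ t, side t = true → lp t ≠ p t ∧ lp t ≠ q t ∧ e1 t ≠ p t ∧ e1 t ≠ q t ∧ e2 t ≠ p t ∧ e2 t ≠ q t ∧
      e1 t ≠ e2 t ∧ e1 t ≠ lp t ∧ e2 t ≠ lp t)
    (φ : Fin 5 → Fin 5 → ℂ) (hper : (Matrix.of fun c s => φ s c).permanent ≠ 0)
    (hkS : ∀ k, ∑ y, φ (i k) y * α k y = 0)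
    (hkU : ∀ t, side t = false →
      ∑ y, φ (lp t) y * ∑ a, φ (op t) a *
        u t (Function.update (Function.update (fun _ => (0 : Fin 5)) (op t) a) (lp t) y) = 0)
    (hkW : ∀ t, side t = true →
      ∑ z, φ (lp t) z * ∑ xy : Fin 5 × Fin 5, φ (e1 t) xy.1 * φ (e2 t) xy.2 *
        w t (Function.update (Function.update (Function.update (fun _ => (0 : Fin 5)) (e1 t) xy.1) (e2 t) xy.2)
          (lp t) z) = 0) :
    ¬ ∀ v : Fin 5 → Fin 5,
      (if Function.Injective v then (1 : ℂ) else 0) = (∑ k, α k (v (i k)) * W k v) + ∑ t, u t v * w t v := by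
  classical
  intro H
  let c0 : Fin 5 := 0
  -- the decomposition in the data format of `LaplaceOptimal 5`
  let S : Fin (Ns + Np) → Finset (Fin 5) := Fin.addCases (fun k => ({i k} : Finset (Fin 5))) (fun t => {p t, q t})
  let U : Fin (Ns + Np) → (Fin 5 → Fin 5) → ℂ := Fin.addCases (fun k v => α k (v (i k))) (fun t => u t)
  let V : Fin (Ns + Np) → (Fin 5 → Fin 5) → ℂ := Fin.addCases W (fun t => w t)
  have hS1 : ∀ k, S (Fin.castAdd Np k) = {i k} := fun k => by simp [S]
  have hS2 : ∀ t, S (Fin.natAdd Ns t) = {p t, q t} := fun t => by simp [S]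
  have hU1 : ∀ k, U (Fin.castAdd Np k) = fun v => α k (v (i k)) := fun k => by simp [U]
  have hU2 : ∀ t, U (Fin.natAdd Ns t) = u t := fun t => by simp [U]
  have hV1 : ∀ k, V (Fin.castAdd Np k) = W k := fun k => by simp [V]
  have hV2 : ∀ t, V (Fin.natAdd Ns t) = w t := fun t => by simp [V]
  refine LaplaceDual.no_decomposition_of_witness (d := 5) (univ : Finset (Fin (Ns + Np))) S U V ?_ ?_ c0 φ hper
    ?_ ?_
  · intro s v v' hvv'
    induction s using Fin.addCases with
    | left k =>
      rw [hU1]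
      have := hvv' (i k) (by rw [hS1]; simp)
      simp [this]
    | right t =>
      rw [hU2]
      exact hu t v v' (hvv' (p t) (by rw [hS2]; simp)) (hvv' (q t) (by rw [hS2]; simp))
  · intro s v v' hvv'
    induction s using Fin.addCases with
    | left k =>
      rw [hV1]
      exact hW k v v' (fun j hj => hvv' j (by rw [hS1]; simpa using hj))
    | right t =>
      rw [hV2]
      exact hw t v v' (fun j hjp hjq => hvv' j (by rw [hS2]; simp [hjp, hjq]))
  · -- every term is killed
    intro s _
    induction s using Fin.addCases with
    | left k =>
      left
      rw [hS1, hU1]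
      refine LaplaceDual.kill_slice (d := 5) c0 (i k) φ (fun v => α k (v (i k))) ?_
      simpa [Function.update_self] using hkS k
    | right t =>
      cases hst : side t
      · -- u-side kill
        have hk := hkU t hst
        left
        rw [hS2, hU2]
        refine LaplaceDual.kill_pair (d := 5) c0 (p t) (q t) (hpq t) φ (u t) ?_
        rcases hsideU t hst with ⟨hl, ho⟩ | ⟨hl, ho⟩
        · -- charged at `p t`, other endpoint `q t`
          rw [hl, ho] at hk
          rw [Fintype.sum_prod_type]
          rw [← hk]
          refine sum_congr rfl fun y _ => ?_
          rw [mul_sum]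
          refine sum_congr rfl fun a _ => ?_
          rw [Function.update_comm (hpq t).symm]
          ring
        · -- charged at `q t`, other endpoint `p t`
          rw [hl, ho] at hk
          rw [Fintype.sum_prod_type, Finset.sum_comm, ← hk]
          refine sum_congr rfl fun y _ => ?_
          rw [mul_sum]
          exact sum_congr rfl fun a _ => by ring
      · -- w-side kill
        have hk := hkW t hst
        right
        rw [hS2, hV2]
        obtain ⟨g1, g2, g3, g4, g5, g6, g7, g8, g9⟩ := hsideW t hst
        rw [pairing_compl_three c0 (p t) (q t) (e1 t) (e2 t) (lp t) (hpq t) g3.symm g5.symm g1.symm g4.symm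
          g6.symm g2.symm g7 g8 g9 φ (w t)]
        rw [← hk]
        symm
        calc (∑ z, φ (lp t) z * ∑ xy : Fin 5 × Fin 5, φ (e1 t) xy.1 * φ (e2 t) xy.2 *
                w t (Function.update (Function.update (Function.update (fun _ => c0) (e1 t) xy.1) (e2 t) xy.2)
                  (lp t) z))
            = ∑ z, ∑ xy : Fin 5 × Fin 5, φ (lp t) z * (φ (e1 t) xy.1 * φ (e2 t) xy.2 *
                w t (Function.update (Function.update (Function.update (fun _ => c0) (e1 t) xy.1) (e2 t) xy.2)
                  (lp t) z)) := by simp_rw [Finset.mul_sum]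
          _ = ∑ zxy : Fin 5 × (Fin 5 × Fin 5), φ (lp t) zxy.1 * (φ (e1 t) zxy.2.1 * φ (e2 t) zxy.2.2 *
                w t (Function.update (Function.update (Function.update (fun _ => c0) (e1 t) zxy.2.1) (e2 t) zxy.2.2)
                  (lp t) zxy.1)) := by rw [Fintype.sum_prod_type]
          _ = _ := by
            refine Fintype.sum_equiv ((Equiv.prodComm _ _).trans (Equiv.prodAssoc _ _ _)) _ _ (fun zxy => ?_)
            obtain ⟨z, x, y⟩ := zxy
            simp only [Equiv.trans_apply, Equiv.prodComm_apply, Prod.swap_prod_mk, Equiv.prodAssoc_apply]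
            ring
  · -- the purported identity
    intro v
    rw [Fin.sum_univ_add]
    simp only [hU1, hU2, hV1, hV2]
    exact (H v).symm

/-! ### §2 The support-core certificate -/

/-- **No decomposition of `P₅` admits a support-core certificate.**  Term data as in `refute_of_kills`; certificate:
slot order `ord`, core positions `j0, j0 + 1 ≤ 4`, kill sides (`side t = false`: charged at `lp t ∈ {p t, q t}` with the
other endpoint `e1 t` EARLIER; `side t = true`: charged at `lp t` with `{e1 t, e2 t, lp t} = {p t, q t}ᶜ`, `e1 t, e2 t`
earlier), and the counts (general position `j`: `#slices + #charged pairs + j + 1 ≤ 5`; `j0`: `… + j0 + 3 ≤ 5`;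
`j0 + 1`: `… + j0 + 1 ≤ 5`).  Then the decomposition identity is impossible. -/
theorem core_no_decomposition {Ns Np : ℕ}
    (i : Fin Ns → Fin 5) (α : Fin Ns → Fin 5 → ℂ) (W : Fin Ns → (Fin 5 → Fin 5) → ℂ)
    (hW : ∀ k, ∀ v v' : Fin 5 → Fin 5, (∀ j, j ≠ i k → v j = v' j) → W k v = W k v')
    (p q : Fin Np → Fin 5) (hpq : ∀ t, p t ≠ q t) (u w : Fin Np → (Fin 5 → Fin 5) → ℂ)
    (hu : ∀ t, ∀ v v' : Fin 5 → Fin 5, v (p t) = v' (p t) → v (q t) = v' (q t) → u t v = u t v')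
    (hw : ∀ t, ∀ v v' : Fin 5 → Fin 5, (∀ j, j ≠ p t → j ≠ q t → v j = v' j) → w t v = w t v')
    -- the certificate
    (ord : Equiv.Perm (Fin 5)) (j0 : ℕ) (hj0 : j0 + 2 ≤ 5)
    (side : Fin Np → Bool) (lp e1 e2 : Fin Np → Fin 5)
    (hsideU : ∀ t, side t = false → (lp t = p t ∧ e1 t = q t ∨ lp t = q t ∧ e1 t = p t) ∧
      ord.symm (e1 t) < ord.symm (lp t))
    (hsideW : ∀ t, side t = true → lp t ≠ p t ∧ lp t ≠ q t ∧ e1 t ≠ p t ∧ e1 t ≠ q t ∧ e2 t ≠ p t ∧ e2 t ≠ q t ∧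
      e1 t ≠ e2 t ∧ e1 t ≠ lp t ∧ e2 t ≠ lp t ∧ ord.symm (e1 t) < ord.symm (lp t) ∧ ord.symm (e2 t) < ord.symm (lp t))
    (hcount : ∀ j : Fin 5, (j : ℕ) ≠ j0 → (j : ℕ) ≠ j0 + 1 →
      (univ.filter (fun k => i k = ord j)).card + (univ.filter (fun t => lp t = ord j)).card + (j : ℕ) + 1 ≤ 5)
    (hcA : (univ.filter (fun k => i k = ord ⟨j0, by omega⟩)).card +
      (univ.filter (fun t => lp t = ord ⟨j0, by omega⟩)).card + j0 + 3 ≤ 5)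
    (hcB : (univ.filter (fun k => i k = ord ⟨j0 + 1, by omega⟩)).card +
      (univ.filter (fun t => lp t = ord ⟨j0 + 1, by omega⟩)).card + j0 + 1 ≤ 5) :
    ¬ ∀ v : Fin 5 → Fin 5,
      (if Function.Injective v then (1 : ℂ) else 0) = (∑ k, α k (v (i k)) * W k v) + ∑ t, u t v * w t v := by
  classical
  -- the charged constraints, indexed by `Fin (Ns + Np)` (slices first)
  let c0 : Fin 5 := 0
  let nU : Fin Np → (Fin 5 → Fin 5 → ℂ) → (Fin 5 → ℂ) := fun t φ y =>
    ∑ a, φ (e1 t) a * u t (Function.update (Function.update (fun _ => c0) (e1 t) a) (lp t) y)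
  let nW : Fin Np → (Fin 5 → Fin 5 → ℂ) → (Fin 5 → ℂ) := fun t φ z =>
    ∑ xy : Fin 5 × Fin 5, φ (e1 t) xy.1 * φ (e2 t) xy.2 *
      w t (Function.update (Function.update (Function.update (fun _ => c0) (e1 t) xy.1) (e2 t) xy.2) (lp t) z)
  let l : Fin (Ns + Np) → Fin 5 := Fin.addCases (fun k => i k) (fun t => lp t)
  let Nv : Fin (Ns + Np) → (Fin 5 → Fin 5 → ℂ) → (Fin 5 → ℂ) :=
    Fin.addCases (fun k _ => α k) (fun t φ => if side t then nW t φ else nU t φ)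
  have hl1 : ∀ k, l (Fin.castAdd Np k) = i k := fun k => by simp [l]
  have hl2 : ∀ t, l (Fin.natAdd Ns t) = lp t := fun t => by simp [l]
  have hN1 : ∀ k φ, Nv (Fin.castAdd Np k) φ = α k := fun k φ => by simp [Nv]
  have hN2 : ∀ t φ, Nv (Fin.natAdd Ns t) φ = if side t then nW t φ else nU t φ := fun t φ => by simp [Nv]
  -- locality
  have hloc : ∀ s, ∀ φ φ' : Fin 5 → Fin 5 → ℂ, (∀ x, ord.symm x < ord.symm (l s) → φ x = φ' x) →
      Nv s φ = Nv s φ' := by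
    intro s φ φ' hφ
    induction s using Fin.addCases with
    | left k => rw [hN1, hN1]
    | right t =>
      rw [hN2, hN2]
      rw [hl2] at hφ
      cases hst : side t
      · simp only [Bool.false_eq_true, if_false, nU]
        rw [hφ (e1 t) (hsideU t hst).2]
      · simp only [if_true, nW]
        obtain ⟨-, -, -, -, -, -, -, -, -, he1, he2⟩ := hsideW t hst
        rw [hφ (e1 t) he1, hφ (e2 t) he2]
  -- the counts in terms of `l`
  have hcard : ∀ s0 : Fin 5, (univ.filter (fun s => l s = s0)).card =
      (univ.filter (fun k => i k = s0)).card + (univ.filter (fun t => lp t = s0)).card := by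
    intro s0
    rw [← Finset.card_map (finSumFinEquiv.symm.toEmbedding)]
    have : (univ.filter (fun s => l s = s0)).map finSumFinEquiv.symm.toEmbedding =
        (univ.filter (fun k : Fin Ns => i k = s0)).map Function.Embedding.inl ∪
          (univ.filter (fun t : Fin Np => lp t = s0)).map Function.Embedding.inr := by
      ext x
      simp only [mem_map, mem_filter, mem_univ, true_and, mem_union, Equiv.toEmbedding_apply,
        Function.Embedding.inl_apply, Function.Embedding.inr_apply]
      constructor
      · rintro ⟨s, hs, rfl⟩
        induction s using Fin.addCases with
        | left k => left; exact ⟨k, by rw [hl1] at hs; exact hs, by simp⟩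
        | right t => right; exact ⟨t, by rw [hl2] at hs; exact hs, by simp⟩
      · rintro (⟨k, hk, rfl⟩ | ⟨t, ht, rfl⟩)
        · exact ⟨Fin.castAdd Np k, by rw [hl1]; exact hk, by simp⟩
        · exact ⟨Fin.natAdd Ns t, by rw [hl2]; exact ht, by simp⟩
    rw [this, card_union_of_disjoint, card_map, card_map]
    rw [disjoint_left]
    rintro x hx hx'
    simp only [mem_map, Function.Embedding.inl_apply, Function.Embedding.inr_apply] at hx hx'
    obtain ⟨k, -, rfl⟩ := hx
    obtain ⟨t, -, h⟩ := hx'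
    exact Sum.inr_ne_inl h
  have hcount' : ∀ j : Fin 5, (j : ℕ) ≠ j0 → (j : ℕ) ≠ j0 + 1 →
      (univ.filter (fun s => l s = ord j)).card + (j : ℕ) + 1 ≤ 5 := by
    intro j h1 h2; rw [hcard]; exact hcount j h1 h2
  have hcA' : (univ.filter (fun s => l s = ord ⟨j0, by omega⟩)).card + j0 + 3 ≤ 5 := by rw [hcard]; exact hcA
  have hcB' : (univ.filter (fun s => l s = ord ⟨j0 + 1, by omega⟩)).card + j0 + 1 ≤ 5 := by rw [hcard]; exact hcB
  obtain ⟨φ, hkill, hper⟩ :=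
    LaplaceTriangular.core_witness (n := 5) ord j0 hj0 l Nv hloc hcount' hcA' hcB'
  -- conclude
  refine refute_of_kills i α W hW p q hpq u w hu hw side lp e1 e1 e2 (fun t ht => (hsideU t ht).1)
    (fun t ht => ?_) φ hper (fun k => ?_) (fun t ht => ?_) (fun t ht => ?_)
  · obtain ⟨g1, g2, g3, g4, g5, g6, g7, g8, g9, -, -⟩ := hsideW t ht
    exact ⟨g1, g2, g3, g4, g5, g6, g7, g8, g9⟩
  · have := hkill (Fin.castAdd Np k)
    rw [hl1, hN1] at this
    exact this
  · have := hkill (Fin.natAdd Ns t)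
    rw [hl2, hN2] at this
    simpa only [ht, Bool.false_eq_true, if_false, nU] using this
  · have := hkill (Fin.natAdd Ns t)
    rw [hl2, hN2] at this
    simpa only [ht, if_true, nW] using this

end LaplaceFiveSlices

end Summit.ValiantsHypothesis.ValiantsHypothesis.Theorems.RigidityForcesSymmetryRankRigidMinimalRepr
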